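import Mathlib.Geometry.Manifold.Metrizable
import Mathlib.Topology.Ultrafilter
import Literature.Geometry.Lorentzian.LocalCausalRelationClosed
import Literature.Geometry.Lorentzian.LocalTimeSeparation
import HarnessLib

/-!
# Limit sequences of causal curves in a compact set, with the length estimate
(O'Neill 1983, Ch. 14, Prop. 14.8 (3), Lemmas 14.13 and 14.14)

Let `(M, g, τ)` be a strongly causal time-oriented Lorentzian manifold (smooth metric, Hausdorff,
second countable, no boundary) and `αₘ : [0, bₘ] → M` future causal curves contained (for
`𝒰`-almost every `m`, `𝒰` an ultrafilter on `ℕ`) in a fixed compact set `K`, with initial points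
converging along `𝒰` to `p`. We run O'Neill's limit-sequence construction (Ch. 14, Def. 14.7 and
Prop. 14.8, as in `CausalLimitSequence.limitSequence_alternative`) keeping track of lengths, and
prove `LorentzianMetric.exists_limit_chain_arcLength_le`: there are finitely many vertices
`p = v₀ ≤ v₁ ≤ ⋯ ≤ v_k` with `αₘ(bₘ) → v_k` along `𝒰`, consecutive vertices joined by radial
geodesic segments `vᵢ₊₁ = exp_{vᵢ}(wᵢ)`, `wᵢ` future causal or zero, lying in prescribed small
neighbourhoods, such that **every `𝒰`-eventual lower bound `L₀` of the lengths `L(αₘ)` satisfies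
`L₀ ≤ ∑ᵢ |wᵢ| ≤ ∑ᵢ τ(vᵢ, vᵢ₊₁)`** (`|w| = √(-g(w, w))`). This is the content of O'Neill's
Prop. 14.8 (3) (finiteness of the limit sequence for curves in a relatively compact set, by strong
causality) and of Lemma 14.14 (p. 408: *"`L(λ) ≥ lim sup L(αₘ)`"*, proved through Lemma 14.13,
*"`lim L(αₘ|[sₘᵢ, sₘ₍ᵢ₊₁₎]) ≤ L(λᵢ)`"*): the length of each piece `αₘ|[sₘᵢ, sₘ₍ᵢ₊₁₎]` inside a
convex normal neighbourhood is at most the radial distance of its endpoints (local twin paradox,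
`exists_nhds_arcLength_le_radial`), which is continuous and converges to `|wᵢ|`, the length of
the radial geodesic from `vᵢ` to `vᵢ₊₁`, itself at most `τ(vᵢ, vᵢ₊₁)`.

Everything is proved; no definitions and no named facts are introduced (D-0026).

## References

* B. O'Neill, *Semi-Riemannian geometry with applications to relativity*, Academic Press 1983,
  Ch. 14, Def. 14.7, Prop. 14.8, Lemmas 14.13, 14.14 (pp. 404–409). [ONeillSemiRiemannian1983]
-/

noncomputable section

open Set Filter Metric TopologicalSpace Function
open scoped Topology Manifold ContDiff ENNReal

namespace Literature.Geometry.Lorentzian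

open Literature.Geometry.Riemannian

variable {E : Type*} [NormedAddCommGroup E] [NormedSpace ℝ E] {H : Type*} [TopologicalSpace H]
  {I : ModelWithCorners ℝ E H} {M : Type*} [TopologicalSpace M] [ChartedSpace H M]
  [IsManifold I ∞ M]

namespace LorentzianMetric

variable {n : ℕ∞ω} {g : LorentzianMetric I n M} {τ : TimeOrientation g}

/-- Arc length of a curve over consecutive parameter intervals adds up (iterated
`arcLength_add`). [folklore] -/
lemma arcLength_eq_sum_of_monotone (γ : ℝ → M) (s : ℕ → ℝ) (k : ℕ)
    (hs : ∀ i < k, s i ≤ s (i + 1)) :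
    g.arcLength γ (s 0) (s k) = ∑ i ∈ Finset.range k, g.arcLength γ (s i) (s (i + 1)) := by
  induction k with
  | zero => simp [PseudoRiemannianMetric.arcLength]
  | succ k ih =>
    have hs' : ∀ i < k, s i ≤ s (i + 1) := fun i hi ↦ hs i (Nat.lt_succ_of_lt hi)
    have hmono : s 0 ≤ s k := by
      clear ih
      induction k with
      | zero => exact le_rfl
      | succ j ihj =>
        exact (ihj (fun i hi ↦ hs i (Nat.lt_succ_of_lt hi))
          (fun i hi ↦ hs' i (Nat.lt_succ_of_lt hi))).trans (hs' j (Nat.lt_succ_self j))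
    rw [Finset.sum_range_succ, ← ih hs']
    exact (PseudoRiemannianMetric.arcLength_add (g := g.toPseudoRiemannianMetric) γ hmono
      (hs k (Nat.lt_succ_self k))).symm

variable [FiniteDimensional ℝ E] [CompleteSpace E] [T2Space M] [SecondCountableTopology M]
  [I.Boundaryless] [g.HasLeviCivita]
  [CovariantDerivative.ContMDiffCovariantDerivative g.leviCivita 1] (τ)

set_option maxHeartbeats 1600000 in
/-- **Limit sequence of causal curves in a compact set, with the length estimate** (O'Neill 1983,
Ch. 14, Prop. 14.8 (3) and Lemma 14.14). Let `(M, g, τ)` be strongly causal, `𝒰` an ultrafilter on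
`ℕ`, `αₘ : [0, bₘ] → M` future causal curves lying in the compact set `K` (for `𝒰`-almost every
`m`) with `αₘ(0) → p` along `𝒰`, and `V c` a neighbourhood of `c` for every `c`. Then there are
`k`, vertices `v₀ = p, v₁, …, v_k` with `αₘ(bₘ) → v_k` along `𝒰`, `vᵢ₊₁ ≠ vᵢ` for `i + 1 < k`,
centres `cᵢ` and vectors `wᵢ` (`i < k`) such that `vᵢ, vᵢ₊₁ ∈ V cᵢ`, `wᵢ ∈ 𝓔_{vᵢ}`, `exp_{vᵢ}(wᵢ) = vᵢ₊₁`, `wᵢ = 0` or `wᵢ` is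
future-directed causal, `vᵢ₊₁ ∈ J⁺(vᵢ)`, `|wᵢ| ≤ τ(vᵢ, vᵢ₊₁)`, and every `𝒰`-eventual lower bound
`L₀` of `L(αₘ|[0, bₘ])` satisfies `L₀ ≤ ∑_{i<k} |wᵢ|`.
[cite: ONeillSemiRiemannian1983, Ch. 14, Prop. 14.8 (3) and Lemma 14.14 (pp. 405–409)] -/
theorem exists_limit_chain_arcLength_le (hn : (∞ : ℕ∞ω) ≤ n) (hsc : g.IsStronglyCausal τ)
    (𝒰 : Ultrafilter ℕ) {α : ℕ → ℝ → M} {b : ℕ → ℝ}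
    (hα : ∀ᶠ m in (𝒰 : Filter ℕ), 0 ≤ b m ∧ g.IsFutureCausalCurveOn τ (α m) (Icc 0 (b m)))
    {K : Set M} (hK : IsCompact K)
    (hαK : ∀ᶠ m in (𝒰 : Filter ℕ), MapsTo (α m) (Icc 0 (b m)) K)
    (V : M → Set M) (hV : ∀ c, V c ∈ 𝓝 c)
    {p : M} (hp : Tendsto (fun m ↦ α m 0) (𝒰 : Filter ℕ) (𝓝 p)) :
    ∃ (k : ℕ) (v : ℕ → M) (c : ℕ → M) (w : ℕ → E),
      v 0 = p ∧ Tendsto (fun m ↦ α m (b m)) (𝒰 : Filter ℕ) (𝓝 (v k)) ∧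
      (∀ i, i + 1 < k → v (i + 1) ≠ v i) ∧
      (∀ i < k, v i ∈ V (c i) ∧ v (i + 1) ∈ V (c i) ∧
        (w i : TangentSpace I (v i)) ∈ expDomain g.leviCivita (v i) ∧
        expMap g.leviCivita (v i) (w i : TangentSpace I (v i)) = v (i + 1) ∧
        (w i = 0 ∨ τ.IsFutureDirected (x := v i) (w i)) ∧
        g.val (v i) (w i) (w i) ≤ 0 ∧
        v (i + 1) ∈ g.causalFuture τ {v i} ∧
        ENNReal.ofReal (Real.sqrt (-g.val (v i) (w i) (w i))) ≤
          g.lorentzDist τ (v i) (v (i + 1))) ∧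
      ∀ L₀ : ℝ≥0∞, (∀ᶠ m in (𝒰 : Filter ℕ), L₀ ≤ g.arcLength (α m) 0 (b m)) →
        L₀ ≤ ∑ i ∈ Finset.range k, ENNReal.ofReal (Real.sqrt (-g.val (v i) (w i) (w i))) := by
  classical
  haveI : Fact (1 ≤ n) := ⟨le_trans (by exact_mod_cast le_top) hn⟩
  have hn1 : (1 : ℕ∞ω) ≤ n := Fact.out
  have hn2 : (2 : ℕ∞ω) ≤ n :=
    le_trans (WithTop.coe_le_coe.mpr le_top : (2 : ℕ∞ω) ≤ ((⊤ : ℕ∞) : ℕ∞ω)) hn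
  haveI : LocallyCompactSpace M := Manifold.locallyCompact_of_finiteDimensional (M := M) I
  haveI : MetrizableSpace M := Manifold.metrizableSpace I M
  letI : MetricSpace M := metrizableSpaceMetric M
  haveI : BoundarylessManifold I M := inferInstance
  /- (1) the neighbourhoods: `≤` closed (`W₁`), radial length bound (`W₂`, `Ξ`), and `V` -/
  choose W₁ hW₁o hcW₁ hW₁ using fun c : M ↦ exists_nhds_causalRelation_closed τ hn c
  choose W₂ Ξ hW₂o hcW₂ hW₂src hΞs hΞ hcurve using
    fun c : M ↦ exists_nhds_arcLength_le_radial τ hn c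
  let W : M → Set M := fun c ↦ W₁ c ∩ W₂ c ∩ interior (V c)
  have hWo : ∀ c, IsOpen (W c) := fun c ↦ ((hW₁o c).inter (hW₂o c)).inter isOpen_interior
  have hcW : ∀ c, c ∈ W c := fun c ↦ ⟨⟨hcW₁ c, hcW₂ c⟩, mem_interior_iff_mem_nhds.2 (hV c)⟩
  have hWW₁ : ∀ c, W c ⊆ W₁ c := fun c x hx ↦ hx.1.1
  have hWW₂ : ∀ c, W c ⊆ W₂ c := fun c x hx ↦ hx.1.2
  have hWV : ∀ c, W c ⊆ V c := fun c x hx ↦ interior_subset hx.2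
  /- (2) the radius function (verbatim from `limitSequence_alternative`) -/
  let A : M → Set ℝ := fun v ↦
    {ρ : ℝ | 0 < ρ ∧ ρ ≤ 1 ∧ IsCompact (closedBall v ρ) ∧ ∃ c, closedBall v ρ ⊆ W c}
  have hA_down : ∀ v, ∀ ρ ∈ A v, ∀ ρ', 0 < ρ' → ρ' ≤ ρ → ρ' ∈ A v := by
    rintro v ρ ⟨-, hρ1, hρc, c, hρW⟩ ρ' hρ'0 hρ'ρ
    exact ⟨hρ'0, hρ'ρ.trans hρ1, hρc.of_isClosed_subset isClosed_closedBall
      (closedBall_subset_closedBall hρ'ρ), c, (closedBall_subset_closedBall hρ'ρ).trans hρW⟩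
  have hAne : ∀ v, (A v).Nonempty := by
    intro v
    obtain ⟨K', hK'c, hK'v⟩ := exists_compact_mem_nhds v
    obtain ⟨δ, hδ, hδK⟩ := Metric.mem_nhds_iff.mp hK'v
    obtain ⟨ε, hε, hεW⟩ := Metric.mem_nhds_iff.mp ((hWo v).mem_nhds (hcW v))
    refine ⟨min 1 (min (δ / 2) (ε / 2)), lt_min one_pos (lt_min (by positivity) (by positivity)),
      min_le_left _ _, ?_, v, ?_⟩
    · refine hK'c.of_isClosed_subset isClosed_closedBall ((closedBall_subset_ball ?_).trans hδK)
      exact lt_of_le_of_lt ((min_le_right _ _).trans (min_le_left _ _)) (by linarith)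
    · refine (closedBall_subset_ball ?_).trans hεW
      exact lt_of_le_of_lt ((min_le_right _ _).trans (min_le_right _ _)) (by linarith)
  have hAbdd : ∀ v, BddAbove (A v) := fun v ↦ ⟨1, fun ρ hρ ↦ hρ.2.1⟩
  let r : M → ℝ := fun v ↦ sSup (A v) / 2
  have hRpos : ∀ v, 0 < sSup (A v) := by
    intro v
    obtain ⟨ρ, hρ⟩ := hAne v
    exact lt_of_lt_of_le hρ.1 (le_csSup (hAbdd v) hρ)
  have hrpos : ∀ v, 0 < r v := fun v ↦ half_pos (hRpos v)
  have hrA : ∀ v, r v ∈ A v := by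
    intro v
    obtain ⟨ρ, hρ, hrρ⟩ := exists_lt_of_lt_csSup (hAne v) (half_lt_self (hRpos v))
    exact hA_down v ρ hρ (r v) (hrpos v) hrρ.le
  have hrK : ∀ v, IsCompact (closedBall v (r v)) := fun v ↦ (hrA v).2.2.1
  choose c hcW' using fun v ↦ (hrA v).2.2.2
  have hr_lower : ∀ q : M, ∃ r₀ > 0, ∀ v, dist v q < 2 * r₀ → r₀ ≤ r v := by
    intro q
    obtain ⟨ρ₀, hρ₀⟩ := hAne q
    refine ⟨ρ₀ / 4, by linarith [hρ₀.1], fun v hv ↦ ?_⟩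
    have hmem : ρ₀ / 2 ∈ A v := by
      have hsub : closedBall v (ρ₀ / 2) ⊆ closedBall q ρ₀ :=
        closedBall_subset_closedBall' (by linarith [hv.le])
      obtain ⟨c₀, hc₀⟩ := hρ₀.2.2.2
      exact ⟨by linarith [hρ₀.1], by linarith [hρ₀.2.1],
        hρ₀.2.2.1.of_isClosed_subset isClosed_closedBall hsub, c₀, hsub.trans hc₀⟩
    have h := le_csSup (hAbdd v) hmem
    show ρ₀ / 4 ≤ sSup (A v) / 2
    linarith
  /- (3) the local length functional `Λ c x y = |exp_x⁻¹ y|` read through the package at `c`,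
  and its continuity -/
  let e : M → _ := fun c₀ : M ↦ trivializationAt E (TangentSpace I : M → Type _) c₀
  let Q : M → M → M → ℝ := fun c₀ x y ↦
    g.val x ((e c₀).symmL ℝ x (Ξ c₀ x y)) ((e c₀).symmL ℝ x (Ξ c₀ x y))
  let P : M → M → M → ℝ := fun c₀ x y ↦
    g.val x (τ.vectorField x) ((e c₀).symmL ℝ x (Ξ c₀ x y))
  have hQP_cont : ∀ c₀, ContinuousOn (fun xy : M × M ↦ (Q c₀ xy.1 xy.2, P c₀ xy.1 xy.2))
      (W₂ c₀ ×ˢ W₂ c₀) := by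
    intro c₀
    let φ := extChartAt I c₀
    have hφc : ContinuousOn φ (chartAt H c₀).source := by
      rw [← extChartAt_source I c₀]; exact continuousOn_extChartAt c₀
    have hGc : ContinuousOn (g.coordMetric c₀) φ.target :=
      (g.contDiffOn_coordMetric hn1 c₀).continuousOn
    have hTc : ContinuousOn (τ.coordTime c₀) φ.target := τ.continuousOn_coordTime hn1 c₀
    have hmapt : ∀ x ∈ W₂ c₀, φ x ∈ φ.target := fun x hx ↦
      φ.map_source (by rw [extChartAt_source]; exact hW₂src c₀ hx)
    -- the coordinate expressions
    have h1 : ContinuousOn (fun xy : M × M ↦ φ xy.1) (W₂ c₀ ×ˢ W₂ c₀) :=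
      hφc.comp continuous_fst.continuousOn fun xy hxy ↦ hW₂src c₀ hxy.1
    have h2 : ContinuousOn (fun xy : M × M ↦ Ξ c₀ xy.1 xy.2) (W₂ c₀ ×ˢ W₂ c₀) :=
      (hΞs c₀).continuousOn
    have h3 : ContinuousOn (fun xy : M × M ↦ g.coordMetric c₀ (φ xy.1)) (W₂ c₀ ×ˢ W₂ c₀) :=
      hGc.comp h1 fun xy hxy ↦ hmapt _ hxy.1
    have h4 : ContinuousOn (fun xy : M × M ↦ τ.coordTime c₀ (φ xy.1)) (W₂ c₀ ×ˢ W₂ c₀) :=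
      hTc.comp h1 fun xy hxy ↦ hmapt _ hxy.1
    have hQ' : ContinuousOn (fun xy : M × M ↦
        g.coordMetric c₀ (φ xy.1) (Ξ c₀ xy.1 xy.2) (Ξ c₀ xy.1 xy.2)) (W₂ c₀ ×ˢ W₂ c₀) :=
      (h3.clm_apply h2).clm_apply h2
    have hP' : ContinuousOn (fun xy : M × M ↦
        g.coordMetric c₀ (φ xy.1) (τ.coordTime c₀ (φ xy.1)) (Ξ c₀ xy.1 xy.2))
        (W₂ c₀ ×ˢ W₂ c₀) :=
      (h3.clm_apply h4).clm_apply h2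
    -- identification with `Q`, `P`
    have hid : ∀ xy ∈ W₂ c₀ ×ˢ W₂ c₀,
        g.coordMetric c₀ (φ xy.1) (Ξ c₀ xy.1 xy.2) (Ξ c₀ xy.1 xy.2) = Q c₀ xy.1 xy.2 ∧
        g.coordMetric c₀ (φ xy.1) (τ.coordTime c₀ (φ xy.1)) (Ξ c₀ xy.1 xy.2) =
          P c₀ xy.1 xy.2 := by
      intro xy hxy
      have hsrc : xy.1 ∈ φ.source := by rw [extChartAt_source]; exact hW₂src c₀ hxy.1
      have ht : φ xy.1 ∈ φ.target := hmapt _ hxy.1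
      have hA := g.coordMetric_apply (p := c₀) ht (Ξ c₀ xy.1 xy.2) (Ξ c₀ xy.1 xy.2)
      have hB := coordMetric_coordTime_apply (τ := τ) (p := c₀) ht (Ξ c₀ xy.1 xy.2)
      rw [φ.left_inv hsrc] at hA hB
      exact ⟨hA, hB⟩
    refine ContinuousOn.prodMk (hQ'.congr fun xy hxy ↦ ((hid xy hxy).1).symm)
      (hP'.congr fun xy hxy ↦ ((hid xy hxy).2).symm)
  /- (4) one stage of the construction -/
  -- the data carried from a vertex to the next: markers `s ≤ s'`, the segments
  -- `αₘ|[sₘ, s'ₘ]` inside `closedBall v (r v)`, the limits `v`, `v'`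
  have hstage : ∀ (s : ℕ → ℝ) (v : M),
      (∀ᶠ m in (𝒰 : Filter ℕ), s m ∈ Icc 0 (b m)) →
      Tendsto (fun m ↦ α m (s m)) (𝒰 : Filter ℕ) (𝓝 v) →
      ∃ (s' : ℕ → ℝ) (v' : M), (∀ᶠ m in (𝒰 : Filter ℕ), s' m ∈ Icc (s m) (b m)) ∧
        Tendsto (fun m ↦ α m (s' m)) (𝒰 : Filter ℕ) (𝓝 v') ∧
        v' ∈ closedBall v (r v) ∧
        (∀ᶠ m in (𝒰 : Filter ℕ), ∀ t ∈ Icc (s m) (s' m), α m t ∈ closedBall v (r v)) ∧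
        ((∀ᶠ m in (𝒰 : Filter ℕ), s' m = b m) ∨
          ((∀ᶠ m in (𝒰 : Filter ℕ), ∃ t ∈ Icc (s m) (b m), α m t ∉ ball v (r v)) ∧
            r v ≤ dist v v')) := by
    intro s v hs hsv
    let B : Set M := ball v (r v)
    have hvB : v ∈ B := mem_ball_self (hrpos v)
    have hgood : ∀ᶠ m in (𝒰 : Filter ℕ), s m ∈ Icc 0 (b m) ∧
        g.IsFutureCausalCurveOn τ (α m) (Icc 0 (b m)) ∧ α m (s m) ∈ B := by
      filter_upwards [hs, hα, hsv.eventually_mem (isOpen_ball.mem_nhds hvB)] with m h1 h2 h3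
      exact ⟨h1, h2.2, h3⟩
    by_cases hleave : ∀ᶠ m in (𝒰 : Filter ℕ), ∃ t ∈ Icc (s m) (b m), α m t ∉ B
    · /- CONTINUE: first exit points -/
      let T : ℕ → Set ℝ := fun m ↦ {t | t ∈ Icc (s m) (b m) ∧ α m t ∉ B}
      let s' : ℕ → ℝ := fun m ↦ if (T m).Nonempty then sInf (T m) else s m
      have hexit : ∀ m, s m ∈ Icc 0 (b m) → g.IsFutureCausalCurveOn τ (α m) (Icc 0 (b m)) →
          α m (s m) ∈ B → (∃ t ∈ Icc (s m) (b m), α m t ∉ B) →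
          s' m ∈ Icc (s m) (b m) ∧ α m (s' m) ∈ closedBall v (r v) \ B ∧
          ∀ t ∈ Icc (s m) (s' m), α m t ∈ closedBall v (r v) := by
        intro m hsm hαm hsmB hex
        have hTne : (T m).Nonempty := by
          obtain ⟨t, ht, htB⟩ := hex; exact ⟨t, ht, htB⟩
        have hs'eq : s' m = sInf (T m) := if_pos hTne
        have hcont : ContinuousOn (α m) (Icc (s m) (b m)) := fun t ht ↦
          (hαm t ⟨hsm.1.trans ht.1, ht.2⟩).1.continuousAt.continuousWithinAt
        have hTclosed : IsClosed (T m) :=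
          hcont.preimage_isClosed_of_isClosed isClosed_Icc isOpen_ball.isClosed_compl
        have hTbdd : BddBelow (T m) := ⟨s m, fun t ht ↦ ht.1.1⟩
        have hmem : s' m ∈ T m := by rw [hs'eq]; exact hTclosed.csInf_mem hTne hTbdd
        have hmin : ∀ t ∈ T m, s' m ≤ t := fun t ht ↦ by rw [hs'eq]; exact csInf_le hTbdd ht
        have hs's : s m < s' m := by
          rcases hmem.1.1.eq_or_lt with h | h
          · exact absurd (h ▸ hsmB) hmem.2
          · exact h
        have hbefore : ∀ t ∈ Ico (s m) (s' m), α m t ∈ B := by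
          intro t ht
          by_contra htB
          exact (not_le.mpr ht.2) (hmin t ⟨⟨ht.1, ht.2.le.trans hmem.1.2⟩, htB⟩)
        have hcl : α m (s' m) ∈ closedBall v (r v) := by
          have hca : ContinuousAt (α m) (s' m) :=
            (hαm (s' m) ⟨hsm.1.trans hmem.1.1, hmem.1.2⟩).1.continuousAt
          have hlim : Tendsto (α m) (𝓝[<] s' m) (𝓝 (α m (s' m))) :=
            hca.tendsto.mono_left nhdsWithin_le_nhds
          have hev : ∀ᶠ t in 𝓝[<] s' m, α m t ∈ B := by
            filter_upwards [Ioo_mem_nhdsLT hs's] with t ht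
            exact hbefore t ⟨ht.1.le, ht.2⟩
          exact closure_ball_subset_closedBall (mem_closure_of_tendsto hlim hev)
        refine ⟨hmem.1, ⟨hcl, hmem.2⟩, fun t ht ↦ ?_⟩
        rcases ht.2.eq_or_lt with h | h
        · rw [h]; exact hcl
        · exact ball_subset_closedBall (hbefore t ⟨ht.1, h⟩)
      have hgood' : ∀ᶠ m in (𝒰 : Filter ℕ), s' m ∈ Icc (s m) (b m) ∧
          α m (s' m) ∈ closedBall v (r v) \ B ∧
          (∀ t ∈ Icc (s m) (s' m), α m t ∈ closedBall v (r v)) := by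
        filter_upwards [hgood, hleave] with m hm hl
        exact hexit m hm.1 hm.2.1 hm.2.2 hl
      have hC : IsCompact (closedBall v (r v) \ B) := (hrK v).diff isOpen_ball
      have hle : (↑(𝒰.map fun m ↦ α m (s' m)) : Filter M) ≤ 𝓟 (closedBall v (r v) \ B) := by
        rw [Ultrafilter.coe_map, le_principal_iff, mem_map]
        filter_upwards [hgood'] with m hm
        exact hm.2.1
      obtain ⟨v', hv'C, hv'⟩ := hC.ultrafilter_le_nhds _ hle
      have hsv' : Tendsto (fun m ↦ α m (s' m)) (𝒰 : Filter ℕ) (𝓝 v') := by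
        rw [Ultrafilter.coe_map] at hv'
        exact hv'
      refine ⟨s', v', ?_, hsv', hv'C.1, ?_, Or.inr ⟨hleave, ?_⟩⟩
      · filter_upwards [hgood'] with m hm
        exact hm.1
      · filter_upwards [hgood'] with m hm
        exact hm.2.2
      · have h : ¬ dist v' v < r v := fun h ↦ hv'C.2 (mem_ball.mpr h)
        rw [dist_comm] at h
        exact not_lt.mp h
    · /- STOP: the tails are trapped in the ball -/
      have hstay : ∀ᶠ m in (𝒰 : Filter ℕ), ∀ t ∈ Icc (s m) (b m), α m t ∈ B := by
        filter_upwards [(Ultrafilter.eventually_not (f := 𝒰)).mpr hleave] with m hm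
        intro t ht
        by_contra htB
        exact hm ⟨t, ht, htB⟩
      have hle : (↑(𝒰.map fun m ↦ α m (b m)) : Filter M) ≤ 𝓟 (closedBall v (r v)) := by
        rw [Ultrafilter.coe_map, le_principal_iff, mem_map]
        filter_upwards [hgood, hstay] with m hm hst
        exact ball_subset_closedBall (hst (b m) ⟨hm.1.2, le_rfl⟩)
      obtain ⟨q, hqC, hq⟩ := (hrK v).ultrafilter_le_nhds _ hle
      have hbq : Tendsto (fun m ↦ α m (b m)) (𝒰 : Filter ℕ) (𝓝 q) := by
        rw [Ultrafilter.coe_map] at hq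
        exact hq
      refine ⟨b, q, ?_, hbq, hqC, ?_, Or.inl (Eventually.of_forall fun m ↦ rfl)⟩
      · filter_upwards [hgood] with m hm
        exact ⟨hm.1.2, le_rfl⟩
      · filter_upwards [hstay] with m hm
        exact fun t ht ↦ ball_subset_closedBall (hm t ht)
  /- (5) iterate the stages -/
  let St := {sv : (ℕ → ℝ) × M // (∀ᶠ m in (𝒰 : Filter ℕ), sv.1 m ∈ Icc 0 (b m)) ∧
    Tendsto (fun m ↦ α m (sv.1 m)) (𝒰 : Filter ℕ) (𝓝 sv.2)}
  have hst₀ : (∀ᶠ m in (𝒰 : Filter ℕ), (fun _ : ℕ ↦ (0 : ℝ)) m ∈ Icc 0 (b m)) ∧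
      Tendsto (fun m ↦ α m ((fun _ : ℕ ↦ (0 : ℝ)) m)) (𝒰 : Filter ℕ) (𝓝 p) := by
    refine ⟨?_, hp⟩
    filter_upwards [hα] with m hm
    exact ⟨le_rfl, hm.1⟩
  let st₀ : St := ⟨(fun _ ↦ 0, p), hst₀⟩
  -- the relation "`σ'` is the output of the stage at `σ`"
  let Rel : St → St → Prop := fun σ σ' ↦
    (∀ᶠ m in (𝒰 : Filter ℕ), σ'.1.1 m ∈ Icc (σ.1.1 m) (b m)) ∧
    σ'.1.2 ∈ closedBall σ.1.2 (r σ.1.2) ∧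
    (∀ᶠ m in (𝒰 : Filter ℕ), ∀ t ∈ Icc (σ.1.1 m) (σ'.1.1 m),
      α m t ∈ closedBall σ.1.2 (r σ.1.2)) ∧
    ((∀ᶠ m in (𝒰 : Filter ℕ), σ'.1.1 m = b m) ∨
      ((∀ᶠ m in (𝒰 : Filter ℕ), ∃ t ∈ Icc (σ.1.1 m) (b m), α m t ∉ ball σ.1.2 (r σ.1.2)) ∧
        r σ.1.2 ≤ dist σ.1.2 σ'.1.2))
  have hRel : ∀ σ : St, ∃ σ' : St, Rel σ σ' := by
    intro σ
    obtain ⟨s', v', hs', hsv', hv'B, hseg, halt⟩ := hstage σ.1.1 σ.1.2 σ.2.1 σ.2.2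
    have hs'0 : ∀ᶠ m in (𝒰 : Filter ℕ), s' m ∈ Icc 0 (b m) := by
      filter_upwards [hs', σ.2.1] with m hm hm0
      exact ⟨hm0.1.trans hm.1, hm.2⟩
    exact ⟨⟨(s', v'), hs'0, hsv'⟩, hs', hv'B, hseg, halt⟩
  choose next hnext using hRel
  let seq : ℕ → St := fun i ↦ next^[i] st₀
  have hseq0 : seq 0 = st₀ := rfl
  have hseq_succ : ∀ i, seq (i + 1) = next (seq i) := fun i ↦
    Function.iterate_succ_apply' next i st₀
  let vx : ℕ → M := fun i ↦ (seq i).1.2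
  let sx : ℕ → ℕ → ℝ := fun i ↦ (seq i).1.1
  have hvx0 : vx 0 = p := rfl
  have hsx0 : sx 0 = fun _ ↦ 0 := rfl
  have hstep : ∀ i, Rel (seq i) (seq (i + 1)) := fun i ↦ by rw [hseq_succ]; exact hnext _
  have hsx_mem : ∀ i, ∀ᶠ m in (𝒰 : Filter ℕ), sx i m ∈ Icc 0 (b m) := fun i ↦ (seq i).2.1
  have hvx_lim : ∀ i, Tendsto (fun m ↦ α m (sx i m)) (𝒰 : Filter ℕ) (𝓝 (vx i)) :=
    fun i ↦ (seq i).2.2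
  have hsx_mono : ∀ i, ∀ᶠ m in (𝒰 : Filter ℕ), sx i m ≤ sx (i + 1) m := fun i ↦ by
    filter_upwards [(hstep i).1] with m hm using hm.1
  -- the vertices lie in `K`
  have hKc : IsClosed K := hK.isClosed
  have hvxK : ∀ i, vx i ∈ K := by
    intro i
    refine hKc.mem_of_tendsto (hvx_lim i) ?_
    filter_upwards [hαK, hsx_mem i] with m hm hs
    exact hm hs
  /- (6) the construction stops (strong causality; O'Neill 1983, Prop. 14.8 (3)) -/
  -- "continuing" at stage `i`
  let Cont : ℕ → Prop := fun i ↦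
    (∀ᶠ m in (𝒰 : Filter ℕ), ∃ t ∈ Icc (sx i m) (b m), α m t ∉ ball (vx i) (r (vx i))) ∧
      r (vx i) ≤ dist (vx i) (vx (i + 1))
  have hfin : ∃ i, ¬ Cont i := by
    by_contra hinf
    push Not at hinf
    -- a convergent subsequence of the vertices
    obtain ⟨P₀, -, φ, hφ, hφlim⟩ := hK.tendsto_subseq hvxK
    obtain ⟨r₀, hr₀, hr₀v⟩ := hr_lower P₀
    obtain ⟨V₂, hV₂, hV₂U, hbox⟩ := hsc P₀ (ball P₀ (r₀ / 2)) (ball_mem_nhds _ (by positivity))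
    have hV₂i : interior V₂ ∈ 𝓝 P₀ := interior_mem_nhds.2 hV₂
    have hev : ∀ᶠ k in atTop, vx (φ k) ∈ interior V₂ := hφlim.eventually_mem hV₂i
    obtain ⟨k₀, hk₀⟩ := hev.exists_forall_of_atTop
    let i := φ k₀
    let j := φ (k₀ + 1)
    have hij : i + 1 ≤ j := hφ (Nat.lt_succ_self k₀)
    have hiV : vx i ∈ interior V₂ := hk₀ k₀ le_rfl
    have hjV : vx j ∈ interior V₂ := hk₀ (k₀ + 1) (Nat.le_succ _)
    -- markers are monotone between `i` and `j`
    have hmono : ∀ a b' : ℕ, a ≤ b' → ∀ᶠ m in (𝒰 : Filter ℕ), sx a m ≤ sx b' m := by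
      intro a b' hab
      induction hab with
      | refl => exact Eventually.of_forall fun m ↦ le_rfl
      | step _ ih =>
        filter_upwards [ih, hsx_mono _] with m h1 h2 using h1.trans h2
    -- the curves pass through `V₂` at the markers `i` and `j`, hence stay in the small ball
    -- in between, in particular at the marker `i + 1`
    have hin : ∀ᶠ m in (𝒰 : Filter ℕ), α m (sx (i + 1) m) ∈ ball P₀ (r₀ / 2) := by
      have h1 : ∀ᶠ m in (𝒰 : Filter ℕ), α m (sx i m) ∈ interior V₂ :=
        (hvx_lim i).eventually_mem (isOpen_interior.mem_nhds hiV)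
      have h2 : ∀ᶠ m in (𝒰 : Filter ℕ), α m (sx j m) ∈ interior V₂ :=
        (hvx_lim j).eventually_mem (isOpen_interior.mem_nhds hjV)
      filter_upwards [h1, h2, hmono i (i + 1) (Nat.le_succ i), hmono (i + 1) j hij, hα,
        hsx_mem i, hsx_mem j] with m h1 h2 h3 h4 hαm hsi hsj
      rcases (h3.trans h4).eq_or_lt with heq | hlt
      · -- degenerate: `sx i m = sx j m`
        have : sx (i + 1) m = sx i m := le_antisymm (heq ▸ h4) h3
        rw [this]
        exact hV₂U (interior_subset h1)
      · exact hbox (α m) (sx i m) (sx j m) hlt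
          (hαm.2.mono (Icc_subset_Icc hsi.1 hsj.2)) (interior_subset h1) (interior_subset h2)
          (sx (i + 1) m) ⟨h3, h4⟩
    have hcl : vx (i + 1) ∈ closedBall P₀ (r₀ / 2) := by
      have h := (hvx_lim (i + 1))
      have hmem : ∀ᶠ m in (𝒰 : Filter ℕ), α m (sx (i + 1) m) ∈ closedBall P₀ (r₀ / 2) := by
        filter_upwards [hin] with m hm using ball_subset_closedBall hm
      exact isClosed_closedBall.mem_of_tendsto h hmem
    have hiP : dist (vx i) P₀ < r₀ / 2 := mem_ball.1 (hV₂U (interior_subset hiV))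
    have hri : r₀ ≤ r (vx i) := hr₀v (vx i) (by linarith)
    have hd : dist (vx i) (vx (i + 1)) < r₀ := by
      have h1 := dist_triangle (vx i) P₀ (vx (i + 1))
      have h2 : dist P₀ (vx (i + 1)) ≤ r₀ / 2 := by rw [dist_comm]; exact mem_closedBall.1 hcl
      linarith
    linarith [(hinf i).2]
  let i₀ := Nat.find hfin
  have hi₀ : ¬ Cont i₀ := Nat.find_spec hfin
  have hbelow : ∀ i < i₀, Cont i := fun i hi ↦ by
    by_contra h
    exact Nat.find_min hfin hi h
  -- at stage `i₀` the alternative of `Rel` is the STOP branch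
  have hstop : ∀ᶠ m in (𝒰 : Filter ℕ), sx (i₀ + 1) m = b m := by
    rcases (hstep i₀).2.2.2 with h | h
    · exact h
    · exact absurd h hi₀
  /- (7) the output -/
  let k := i₀ + 1
  let cc : ℕ → M := fun i ↦ c (vx i)
  let w : ℕ → E := fun i ↦ (e (cc i)).symmL ℝ (vx i) (Ξ (cc i) (vx i) (vx (i + 1)))
  have hpairW : ∀ i, vx i ∈ W (cc i) ∧ vx (i + 1) ∈ W (cc i) := fun i ↦
    ⟨hcW' (vx i) (mem_closedBall_self (hrpos _).le), hcW' (vx i) (hstep i).2.1⟩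
  -- the limit inequalities `Q ≤ 0`, `P ≤ 0` at each pair, and the length bound
  have hkey : ∀ i, Q (cc i) (vx i) (vx (i + 1)) ≤ 0 ∧ P (cc i) (vx i) (vx (i + 1)) ≤ 0 ∧
      ∀ ε : ℝ, 0 < ε → ∀ᶠ m in (𝒰 : Filter ℕ),
        g.arcLength (α m) (sx i m) (sx (i + 1) m) ≤
          ENNReal.ofReal (Real.sqrt (-Q (cc i) (vx i) (vx (i + 1))) + ε) := by
    intro i
    have hW₂i : vx i ∈ W₂ (cc i) := hWW₂ _ (hpairW i).1
    have hW₂i' : vx (i + 1) ∈ W₂ (cc i) := hWW₂ _ (hpairW i).2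
    -- the package applied to the segments
    have hseg : ∀ᶠ m in (𝒰 : Filter ℕ),
        Q (cc i) (α m (sx i m)) (α m (sx (i + 1) m)) ≤ 0 ∧
        P (cc i) (α m (sx i m)) (α m (sx (i + 1) m)) ≤ 0 ∧
        g.arcLength (α m) (sx i m) (sx (i + 1) m) ≤ ENNReal.ofReal
          (Real.sqrt (-Q (cc i) (α m (sx i m)) (α m (sx (i + 1) m)))) ∧
        (α m (sx i m), α m (sx (i + 1) m)) ∈ W₂ (cc i) ×ˢ W₂ (cc i) := by
      filter_upwards [(hstep i).1, (hstep i).2.2.1, hα, hsx_mem i] with m h1 h2 hαm hsi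
      have hcurve' := hcurve (cc i) (α m) (sx i m) (sx (i + 1) m) h1.1
        (hαm.2.mono (Icc_subset_Icc hsi.1 h1.2))
        (fun t ht ↦ hWW₂ _ (hcW' (vx i) (h2 t ht)))
      refine ⟨hcurve'.1.1, hcurve'.1.2.1, hcurve'.1.2.2, ?_, ?_⟩
      · exact hWW₂ _ (hcW' (vx i) (h2 _ ⟨le_rfl, h1.1⟩))
      · exact hWW₂ _ (hcW' (vx i) (h2 _ ⟨h1.1, le_rfl⟩))
    -- continuity of `(Q, P)` at the limit pair
    have hlim2 : Tendsto (fun m ↦ (α m (sx i m), α m (sx (i + 1) m))) (𝒰 : Filter ℕ)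
        (𝓝[W₂ (cc i) ×ˢ W₂ (cc i)] (vx i, vx (i + 1))) := by
      refine tendsto_nhdsWithin_iff.2 ⟨(hvx_lim i).prodMk_nhds (hvx_lim (i + 1)), ?_⟩
      filter_upwards [hseg] with m hm using hm.2.2.2
    have hQPlim : Tendsto (fun m ↦ (Q (cc i) (α m (sx i m)) (α m (sx (i + 1) m)),
        P (cc i) (α m (sx i m)) (α m (sx (i + 1) m)))) (𝒰 : Filter ℕ)
        (𝓝 (Q (cc i) (vx i) (vx (i + 1)), P (cc i) (vx i) (vx (i + 1)))) :=
      ((hQP_cont (cc i)) (vx i, vx (i + 1)) ⟨hW₂i, hW₂i'⟩).tendsto.comp hlim2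
    have hQlim : Tendsto (fun m ↦ Q (cc i) (α m (sx i m)) (α m (sx (i + 1) m))) (𝒰 : Filter ℕ)
        (𝓝 (Q (cc i) (vx i) (vx (i + 1)))) := (continuous_fst.tendsto _).comp hQPlim
    have hPlim : Tendsto (fun m ↦ P (cc i) (α m (sx i m)) (α m (sx (i + 1) m))) (𝒰 : Filter ℕ)
        (𝓝 (P (cc i) (vx i) (vx (i + 1)))) := (continuous_snd.tendsto _).comp hQPlim
    refine ⟨le_of_tendsto hQlim ?_, le_of_tendsto hPlim ?_, fun ε hε ↦ ?_⟩
    · filter_upwards [hseg] with m hm using hm.1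
    · filter_upwards [hseg] with m hm using hm.2.1
    · have hsq : Tendsto (fun m ↦ Real.sqrt (-Q (cc i) (α m (sx i m)) (α m (sx (i + 1) m))))
          (𝒰 : Filter ℕ) (𝓝 (Real.sqrt (-Q (cc i) (vx i) (vx (i + 1))))) :=
        (Real.continuous_sqrt.tendsto _).comp hQlim.neg
      have hev : ∀ᶠ m in (𝒰 : Filter ℕ),
          Real.sqrt (-Q (cc i) (α m (sx i m)) (α m (sx (i + 1) m))) <
            Real.sqrt (-Q (cc i) (vx i) (vx (i + 1))) + ε :=
        hsq.eventually (Iio_mem_nhds (lt_add_of_pos_right _ hε))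
      filter_upwards [hseg, hev] with m hm hm'
      exact hm.2.2.1.trans (ENNReal.ofReal_le_ofReal hm'.le)
  -- consequences at each pair
  have hpair : ∀ i, (w i : TangentSpace I (vx i)) ∈ expDomain g.leviCivita (vx i) ∧
      expMap g.leviCivita (vx i) (w i : TangentSpace I (vx i)) = vx (i + 1) ∧
      (w i = 0 ∨ τ.IsFutureDirected (x := vx i) (w i)) ∧
      g.val (vx i) (w i) (w i) ≤ 0 ∧
      vx (i + 1) ∈ g.causalFuture τ {vx i} ∧
      ENNReal.ofReal (Real.sqrt (-g.val (vx i) (w i) (w i))) ≤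
        g.lorentzDist τ (vx i) (vx (i + 1)) := by
    intro i
    have hW₂i : vx i ∈ W₂ (cc i) := hWW₂ _ (hpairW i).1
    have hW₂i' : vx (i + 1) ∈ W₂ (cc i) := hWW₂ _ (hpairW i).2
    obtain ⟨hdom, hexp⟩ := hΞ (cc i) (vx i) hW₂i (vx (i + 1)) hW₂i'
    obtain ⟨hQ0, hP0, -⟩ := hkey i
    have hQ0' : g.val (vx i) (w i) (w i) ≤ 0 := hQ0
    have hfut : w i = 0 ∨ τ.IsFutureDirected (x := vx i) (w i) := by
      by_cases hw : w i = 0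
      · exact Or.inl hw
      · right
        have hc : g.IsCausal (x := vx i) (w i) := (g.isCausal_iff _).2 ⟨hQ0', hw⟩
        rcases τ.isFutureDirected_or_isPastDirected_of_isCausal hc with h | h
        · exact h
        · exact absurd h.2 (not_lt.2 hP0)
    have hJ : vx (i + 1) ∈ g.causalFuture τ {vx i} := by
      refine hW₁ (cc i) (𝒰 : Filter ℕ) (fun m ↦ α m (sx i m)) (fun m ↦ α m (sx (i + 1) m))
        (vx i) (vx (i + 1)) (hWW₁ _ (hpairW i).1) (hWW₁ _ (hpairW i).2) (hvx_lim i)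
        (hvx_lim (i + 1)) ?_
      filter_upwards [(hstep i).1, (hstep i).2.2.1, hα, hsx_mem i] with m h1 h2 hαm hsi
      exact ⟨α m, sx i m, sx (i + 1) m, h1.1, hαm.2.mono (Icc_subset_Icc hsi.1 h1.2),
        fun t ht ↦ hWW₁ _ (hcW' (vx i) (h2 t ht)), rfl, rfl⟩
    refine ⟨hdom, hexp, hfut, hQ0', hJ, ?_⟩
    rcases hfut with hw | hw
    · have hz : ∀ u : TangentSpace I (vx i), u = 0 → g.val (vx i) u u = 0 := by
        intro u hu; subst hu; simp
      have h0 : g.val (vx i) (w i) (w i) = 0 := hz (w i) hw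
      rw [h0, neg_zero, Real.sqrt_zero, ENNReal.ofReal_zero]
      exact bot_le
    · have hcurve₀ := isFutureCausalCurveOn_expMap_smul τ hdom hw
      have hlen := arcLength_expMap_smul hn (vx i) hdom hQ0'
      have h0 : (fun r : ℝ ↦ expMap g.leviCivita (vx i) (r • (w i : TangentSpace I (vx i)))) 0
          = vx i := by
        simp only [zero_smul]; exact expMap_zero (cov := g.leviCivita) (vx i)
      have h1 : (fun r : ℝ ↦ expMap g.leviCivita (vx i) (r • (w i : TangentSpace I (vx i)))) 1
          = vx (i + 1) := by
        simp only [one_smul]; exact hexp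
      have h := arcLength_le_lorentzDist one_pos hcurve₀ h0 h1
      rwa [hlen] at h
  /- (8) conclusion -/
  refine ⟨k, vx, cc, w, hvx0, ?_, fun i hi heq ↦ ?_,
    fun i _ ↦ ⟨hWV _ (hpairW i).1, hWV _ (hpairW i).2, hpair i⟩, fun L₀ hL₀ ↦ ?_⟩
  · refine (hvx_lim k).congr' ?_
    filter_upwards [hstop] with m hm
    show α m (sx (i₀ + 1) m) = α m (b m)
    rw [show sx (i₀ + 1) m = b m from hm]
  · -- consecutive vertices before the last stage are `r`-separated, hence distinct
    have hci : Cont i := hbelow i (by omega)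
    have h := hci.2
    rw [heq, dist_self] at h
    exact absurd h (not_le.2 (hrpos _))
  · -- the length estimate
    have hkpos : 0 < (k : ℝ) := by exact_mod_cast Nat.succ_pos i₀
    refine ENNReal.le_of_forall_pos_le_add fun ε hε _ ↦ ?_
    let ε' : ℝ := (ε : ℝ) / k
    have hε' : 0 < ε' := div_pos (by exact_mod_cast hε) hkpos
    have hall : ∀ᶠ m in (𝒰 : Filter ℕ), ∀ i ∈ Finset.range k,
        sx i m ≤ sx (i + 1) m ∧ g.arcLength (α m) (sx i m) (sx (i + 1) m) ≤
          ENNReal.ofReal (Real.sqrt (-Q (cc i) (vx i) (vx (i + 1))) + ε') := by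
      rw [eventually_all_finset]
      intro i _
      filter_upwards [hsx_mono i, (hkey i).2.2 ε' hε'] with m h1 h2 using ⟨h1, h2⟩
    obtain ⟨m, hmL, hm, hmstop⟩ := (hL₀.and (hall.and hstop)).exists
    have hsum := arcLength_eq_sum_of_monotone (g := g) (α m) (fun i ↦ sx i m) k
      fun i hi ↦ (hm i (Finset.mem_range.2 hi)).1
    have hsx0m : sx 0 m = 0 := rfl
    have hsxkm : sx k m = b m := hmstop
    simp only [hsx0m, hsxkm] at hsum
    calc L₀ ≤ g.arcLength (α m) 0 (b m) := hmL
      _ = ∑ i ∈ Finset.range k, g.arcLength (α m) (sx i m) (sx (i + 1) m) := hsum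
      _ ≤ ∑ i ∈ Finset.range k,
            ENNReal.ofReal (Real.sqrt (-Q (cc i) (vx i) (vx (i + 1))) + ε') :=
          Finset.sum_le_sum fun i hi ↦ (hm i hi).2
      _ = ∑ i ∈ Finset.range k, ENNReal.ofReal (Real.sqrt (-g.val (vx i) (w i) (w i))) +
            ∑ i ∈ Finset.range k, ENNReal.ofReal ε' := by
          rw [← Finset.sum_add_distrib]
          refine Finset.sum_congr rfl fun i _ ↦ ?_
          rw [ENNReal.ofReal_add (Real.sqrt_nonneg _) hε'.le]
      _ = ∑ i ∈ Finset.range k, ENNReal.ofReal (Real.sqrt (-g.val (vx i) (w i) (w i))) + ε := by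
          congr 1
          rw [Finset.sum_const, Finset.card_range, nsmul_eq_mul, ← ENNReal.ofReal_natCast,
            ← ENNReal.ofReal_mul (Nat.cast_nonneg _)]
          have : (k : ℝ) * ε' = ε := by
            simp only [ε']; field_simp
          rw [this, ENNReal.ofReal_coe_nnreal]

end LorentzianMetric

end Literature.Geometry.Lorentzian

end
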